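import Literature.Combinatorics.Optimization.ParametricShortestPath

/-!
# LINE `valuative_door` (crux `WeakLifting`, stmt-ValiantsHypothesis-19561) — lane `…RankOneLawFalse`, file 1/3: the
# Gajjar–Radhakrishnan / Carstensen parametric DAG with NATURAL weights and STRICT LEADS

HONEST FRAMING.  Helper (cell `pub-symmetroid`, seat val-sym-lift-p1 g22, 2026-08-29; `--supports 19561 --as helper`).  First file of the kernel
refutation of the skeleton's `ValRankOneLaw` / `ValRankOneSharp` AS TYPED (refuted on paper by pen val-idea-24 g4, critic VERDICT #64).  The
tree's `ParamDAG.exists_paramDAG_leads` (Gajjar–Radhakrishnan 2019 Lemma 7 / Mulmuley–Shah / Carstensen) gives, for `n ≥ 2` and every `m`,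
a parametric DAG on `k + 1 ≤ 3^m (1 + m n) + 1` vertices with `n^m` source–sink paths `P_j`, each beating every other path by a margin `1` on a
whole interval of the parameter; its slopes are rational, its intercepts real.  THIS FILE (`exists_paramDAG_strictLeads_nat`): the same DAG can
be re-weighted with NATURAL-NUMBER intercepts AND slopes so that each `P_j` is still the STRICT unique minimiser at one parameter value `u_j`.
Method: approximate every intercept by a rational within `1/(4(k+1))` (a path has `≤ k` arcs, so costs move by `< 1/4 < 1/2` of the margin),
clear denominators and shift every arc `i → j` by `c·(j − i)` — the tree's telescoping trick of `exists_natSlope`, which adds the same constant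
to every source–sink cost.  Consumed by `…ValuativeDoorPathPencil` (file 2/3) and `…ValuativeDoorRankOneLawFalse` (file 3/3).  Nothing here is a
statement about pencils; closes nothing; 19561 / 18050 / VP ≠ VNP untouched.  [cite: GajjarRadhakrishnan2019, Lemma 7, Thm 1; folklore rescaling]
-/

set_option linter.dupNamespace false
set_option autoImplicit false

namespace Summit.ValiantsHypothesis.ValiantsHypothesis.Theorems.KPlusLogSqLaw.ValDoor

open Finset
open scoped BigOperators Classical
open Literature.Combinatorics.Optimization
open Literature.Combinatorics.Optimization.ParamDAG

/-! ## §1 Rational weights become natural weights by a common denominator and a telescoping shift -/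

/-- **clearing denominators and shifting:** for rational arc weights `q` there are natural weights `wn`, a positive integer `Δ` and a shift
`c` with `wn u v = Δ·q u v + c·(v − u)` on every arc `u < v`. [folklore; the tree's `exists_natSlope` computation, extracted] -/
theorem exists_natWeights_of_rat {k : ℕ} (q : Fin (k + 1) → Fin (k + 1) → ℚ) :
    ∃ (wn : Fin (k + 1) → Fin (k + 1) → ℕ) (Δ c : ℕ), 0 < Δ ∧
      ∀ u v : Fin (k + 1), u < v → ((wn u v : ℕ) : ℝ) = (Δ : ℝ) * (q u v : ℝ) + (c : ℝ) * ((v.val : ℝ) - u.val) := by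
  set Δ : ℕ := ∏ p : Fin (k + 1) × Fin (k + 1), (q p.1 p.2).den with hΔ
  have hΔpos : 0 < Δ := Finset.prod_pos fun p _ => (q p.1 p.2).den_pos
  have hz : ∀ u v, ∃ z : ℤ, (z : ℚ) = (Δ : ℚ) * q u v := by
    intro u v
    have hdvd : (q u v).den ∣ Δ := Finset.dvd_prod_of_mem (fun p : Fin (k + 1) × Fin (k + 1) => (q p.1 p.2).den)
      (Finset.mem_univ (u, v))
    obtain ⟨t, ht⟩ := hdvd
    refine ⟨t * (q u v).num, ?_⟩
    have hmul : q u v * (q u v).den = (q u v).num := Rat.mul_den_eq_num (q u v)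
    rw [ht]
    push_cast
    rw [← hmul]
    ring
  choose z hz using hz
  set c : ℕ := ∑ p : Fin (k + 1) × Fin (k + 1), (z p.1 p.2).natAbs with hc
  have hcz : ∀ u v, -(c : ℤ) ≤ z u v := by
    intro u v
    have h1 : (z u v).natAbs ≤ c :=
      Finset.single_le_sum (f := fun p : Fin (k + 1) × Fin (k + 1) => (z p.1 p.2).natAbs) (fun _ _ => Nat.zero_le _)
        (Finset.mem_univ (u, v))
    have h2 : -((z u v).natAbs : ℤ) ≤ z u v := by
      rcases Int.natAbs_eq (z u v) with h | h <;> omega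
    omega
  refine ⟨fun u v => (z u v + c * ((v.val : ℤ) - u.val)).toNat, Δ, c, hΔpos, fun u v huv => ?_⟩
  have huv' : (u.val : ℤ) + 1 ≤ v.val := by exact_mod_cast Fin.lt_def.1 huv
  have hnn : 0 ≤ z u v + c * ((v.val : ℤ) - u.val) := by nlinarith [hcz u v]
  have h1 : (((z u v + c * ((v.val : ℤ) - u.val)).toNat : ℕ) : ℤ) = z u v + c * ((v.val : ℤ) - u.val) :=
    Int.toNat_of_nonneg hnn
  have h2 : (((z u v + c * ((v.val : ℤ) - u.val)).toNat : ℕ) : ℝ) = ((z u v : ℤ) : ℝ) + (c : ℝ) * ((v.val : ℝ) - u.val) := by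
    have := congrArg (fun x : ℤ => (x : ℝ)) h1
    push_cast at this
    exact this
  have h3 : ((z u v : ℤ) : ℝ) = (Δ : ℝ) * (q u v : ℝ) := by
    have := congrArg (fun x : ℚ => (x : ℝ)) (hz u v)
    push_cast at this
    exact this
  rw [h2, h3]

/-- **rational approximation of real weights.** [folklore: density of `ℚ`] -/
theorem exists_rat_near {k : ℕ} (w : Fin (k + 1) → Fin (k + 1) → ℝ) {δ : ℝ} (hδ : 0 < δ) :
    ∃ q : Fin (k + 1) → Fin (k + 1) → ℚ, ∀ u v, |w u v - (q u v : ℝ)| < δ := by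
  have h : ∀ u v : Fin (k + 1), ∃ q : ℚ, |w u v - (q : ℝ)| < δ := by
    intro u v
    obtain ⟨q, hq1, hq2⟩ := exists_rat_btwn (show w u v - δ < w u v + δ by linarith)
    exact ⟨q, abs_lt.2 ⟨by linarith, by linarith⟩⟩
  choose q hq using h
  exact ⟨q, hq⟩

/-! ## §2 The re-weighted DAG -/

/-- costs along a transferred path of a DAG re-weighted by `Δa·qa + ca·(v − u)` / `Δb·qb + cb·(v − u)`: the `qa`/`qb`-line scaled by `Δa`/`Δb`
plus a path-independent term. [bookkeeping: telescoping `Path.sum_sub_eq`] -/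
theorem cost_transfer_natWeights {k : ℕ} (G : ParamDAG k) (qa qb : Fin (k + 1) → Fin (k + 1) → ℚ)
    (an bn : Fin (k + 1) → Fin (k + 1) → ℕ) (Δa ca Δb cb : ℕ)
    (ha : ∀ u v : Fin (k + 1), u < v → ((an u v : ℕ) : ℝ) = (Δa : ℝ) * (qa u v : ℝ) + (ca : ℝ) * ((v.val : ℝ) - u.val))
    (hb : ∀ u v : Fin (k + 1), u < v → ((bn u v : ℕ) : ℝ) = (Δb : ℝ) * (qb u v : ℝ) + (cb : ℝ) * ((v.val : ℝ) - u.val))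
    (R : G.Path) (μ : ℝ) :
    (R.transfer : (G.withWeights (fun u v => (an u v : ℝ)) (fun u v => (bn u v : ℝ))).Path).cost μ
      = (Δa : ℝ) * (∑ c : Fin R.len, (qa (R.verts c.castSucc) (R.verts c.succ) : ℝ))
        + (Δb : ℝ) * (∑ c : Fin R.len, (qb (R.verts c.castSucc) (R.verts c.succ) : ℝ)) * μ
        + ((ca : ℝ) * k + (cb : ℝ) * k * μ) := by
  rw [Path.cost_eq]
  have hi : (R.transfer : (G.withWeights (fun u v => (an u v : ℝ)) (fun u v => (bn u v : ℝ))).Path).icpt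
      = (Δa : ℝ) * (∑ c : Fin R.len, (qa (R.verts c.castSucc) (R.verts c.succ) : ℝ)) + (ca : ℝ) * k := by
    show ∑ d : Fin R.len, ((an (R.verts d.castSucc) (R.verts d.succ) : ℕ) : ℝ) = _
    rw [Finset.sum_congr rfl fun d _ => ha _ _ (R.strictMono (Fin.castSucc_lt_succ (i := d))),
      Finset.sum_add_distrib, ← Finset.mul_sum, ← Finset.mul_sum, R.sum_sub_eq]
  have hs : (R.transfer : (G.withWeights (fun u v => (an u v : ℝ)) (fun u v => (bn u v : ℝ))).Path).slope
      = (Δb : ℝ) * (∑ c : Fin R.len, (qb (R.verts c.castSucc) (R.verts c.succ) : ℝ)) + (cb : ℝ) * k := by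
    show ∑ d : Fin R.len, ((bn (R.verts d.castSucc) (R.verts d.succ) : ℕ) : ℝ) = _
    rw [Finset.sum_congr rfl fun d _ => hb _ _ (R.strictMono (Fin.castSucc_lt_succ (i := d))),
      Finset.sum_add_distrib, ← Finset.mul_sum, ← Finset.mul_sum, R.sum_sub_eq]
  rw [hi, hs]
  ring

/-- **THE PARAMETRIC DAG WITH NATURAL WEIGHTS AND STRICT LEADS** (Gajjar–Radhakrishnan's `G(1, 0, m)` re-weighted): for `n ≥ 2` and every
`m` there is a parametric DAG on `k + 1 ≤ 3^m (1 + m n) + 1` vertices whose arc intercepts AND slopes are natural numbers, with `n^m` distinct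
source–sink paths `P_j` and parameter values `u_j` at which `P_j` is STRICTLY cheaper than every other source–sink path.
[cite: GajjarRadhakrishnan2019, Lemma 7 / Thm 1; re-weighting folklore] -/
theorem exists_paramDAG_strictLeads_nat (n m : ℕ) (hn : 2 ≤ n) :
    ∃ (k : ℕ) (G : ParamDAG k) (P : Fin (n ^ m) → G.Path) (u : Fin (n ^ m) → ℝ),
      k + 1 ≤ 3 ^ m * (1 + m * n) + 1 ∧ Function.Injective P ∧
      (∀ v w, ∃ a : ℕ, G.wa v w = a) ∧ (∀ v w, ∃ b : ℕ, G.wb v w = b) ∧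
      ∀ (j : Fin (n ^ m)) (Q : G.Path), Q ≠ P j → (P j).cost (u j) < Q.cost (u j) := by
  obtain ⟨k, G₀, P₀, u₀, hk, hP₀, hlead, hrat⟩ := exists_paramDAG_leads n m hn
  -- rational slopes (exact) and rational intercepts (within 1/(4(k+1)))
  choose qb hqb using hrat
  have hδ : (0 : ℝ) < 1 / (4 * ((k : ℝ) + 1)) := by positivity
  obtain ⟨qa, hqa⟩ := exists_rat_near G₀.wa hδ
  obtain ⟨an, Δa, ca, hΔa, han⟩ := exists_natWeights_of_rat qa
  obtain ⟨bn, Δb, cb, hΔb, hbn⟩ := exists_natWeights_of_rat qb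
  set G : ParamDAG k := G₀.withWeights (fun u v => (an u v : ℝ)) (fun u v => (bn u v : ℝ)) with hG
  have hΔaR : (0 : ℝ) < Δa := by exact_mod_cast hΔa
  have hΔbR : (0 : ℝ) < Δb := by exact_mod_cast hΔb
  refine ⟨k, G, fun j => (P₀ j).transfer, fun j => (Δa : ℝ) * u₀ j / Δb, hk, ?_, fun v w => ⟨an v w, rfl⟩,
    fun v w => ⟨bn v w, rfl⟩, ?_⟩
  · intro j j' h
    apply hP₀
    have := congrArg Path.transferBack h
    simpa only [Path.transferBack_transfer] using this
  · intro j Q hQ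
    -- the cost of any transferred path at u_j, through the rational lines at u₀ j
    have hcost : ∀ R : G₀.Path, (R.transfer : G.Path).cost ((Δa : ℝ) * u₀ j / Δb)
        = (Δa : ℝ) * ((∑ c : Fin R.len, (qa (R.verts c.castSucc) (R.verts c.succ) : ℝ)) + R.slope * u₀ j)
          + ((ca : ℝ) * k + (cb : ℝ) * k * ((Δa : ℝ) * u₀ j / Δb)) := by
      intro R
      rw [cost_transfer_natWeights G₀ qa qb an bn Δa ca Δb cb han hbn R]
      have hsl : (∑ c : Fin R.len, (qb (R.verts c.castSucc) (R.verts c.succ) : ℝ)) = R.slope := by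
        unfold Path.slope
        exact Finset.sum_congr rfl fun c _ => (hqb _ _).symm
      rw [hsl]
      field_simp
    -- the rational intercept sum is within 1/4 of the true intercept
    have happrox : ∀ R : G₀.Path, |R.icpt - ∑ c : Fin R.len, (qa (R.verts c.castSucc) (R.verts c.succ) : ℝ)| < 1 / 4 := by
      intro R
      unfold Path.icpt
      rw [← Finset.sum_sub_distrib]
      refine lt_of_le_of_lt (Finset.abs_sum_le_sum_abs _ _) ?_
      calc ∑ c : Fin R.len, |G₀.wa (R.verts c.castSucc) (R.verts c.succ) - (qa (R.verts c.castSucc) (R.verts c.succ) : ℝ)|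
          ≤ ∑ _c : Fin R.len, 1 / (4 * ((k : ℝ) + 1)) := Finset.sum_le_sum fun c _ => (hqa _ _).le
        _ = (R.len : ℝ) * (1 / (4 * ((k : ℝ) + 1))) := by rw [Finset.sum_const, Finset.card_univ, Fintype.card_fin, nsmul_eq_mul]
        _ < 1 / 4 := by
          have hlen : (R.len : ℝ) ≤ k := by exact_mod_cast R.len_le
          rw [mul_one_div, div_lt_div_iff₀ (by positivity) (by norm_num)]
          nlinarith
    -- the lead of P₀ j at u₀ j, margin 1
    have hQ₀ : Q.transferBack ≠ P₀ j := by
      intro h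
      apply hQ
      rw [← Path.transfer_transferBack Q, h]
    have hn2 : (0 : ℝ) ≤ (n : ℝ) ^ 2 - 2 := by
      have : (2 : ℝ) ≤ n := by exact_mod_cast hn
      nlinarith
    have hlead' := hlead j (u₀ j) ⟨le_rfl, by linarith⟩ Q.transferBack hQ₀
    rw [Path.cost_eq, Path.cost_eq] at hlead'
    rw [← Path.transfer_transferBack Q, hcost, hcost]
    have h1 := happrox (P₀ j)
    have h2 := happrox Q.transferBack
    rw [abs_lt] at h1 h2
    have hslopeQ : (Q.transferBack).slope = (Q.transferBack).slope := rfl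
    nlinarith [h1.1, h1.2, h2.1, h2.2, hlead', hΔaR]

end Summit.ValiantsHypothesis.ValiantsHypothesis.Theorems.KPlusLogSqLaw.ValDoor
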